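import Summits.Ventures.YMGap.Thresholds.StarMassGapDimRows
import Summits.Ventures.YMGap.Thresholds.StarSU3CertifiedRows
import HarnessLib

/-!
# Venture YMGap — `SU(3)` in EVERY dimension `2 ≤ d ≤ 10`: the star door fed by the certified one-link modulus `K = 7/5`
# ⇒ `MassGapAt d 3 (β_W/9)` at every Wilson `(d−1)|β_W| ≤ 33/20`

HONEST FRAMING: venture file of the cell `pub-ymgap` (QuantumFields programme), seat engine-2 (g4 draft, g5 landing).  Strong-coupling LATTICE statements
only (`SU(3)` lattice Yang–Mills on `ℤ^d`, Wilson plaquette weight, tree coupling `β_W/3`, 't Hooft `β_W/9`); nothing about the continuum,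
weak coupling, or the Clay problem.  Kernel ARITHMETIC over tree theorems, nothing else: ds-1's general-dimension socket-fed row
`StarDimMassGap.massGapAt_of_oneLinkKRModulus` (ds-4's general-`(d, N)` Lemma G window `StarLemmaGDimSUN.star_window_of_oneLinkKRModulus`,
door polynomial `doorPoly d c = (4d−4)c² + (4d−6)c < 1`, plugged into `StarDimLimit.star_massGapAt_of_windows`) fed with the certified
modulus `StarSU3Certified.su3_oneLinkKRModulus_sevenFifths : OneLinkPoincareSUN 3 (11/30) (4/5) → OneLinkVarianceBound 3 (11/30) (49/20) →
OneLinkKRModulus 3 (11/30) (7/5)` of this seat's `d = 4` file.  The two displayed hypotheses are the SAME certified finite-dimensional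
inequalities as there: H1 `OneLinkPoincareSUN 3 (3/5) (4/5)` (cell `pub-ymgap`, σ2 engines A + B on partition P1, A on P2) and H2
`OneLinkVarianceBound 3 (11/30) (49/20)` (`pub-balaban` g17 + `pub-ymgap` replay); class «K × C(H1: A@P1+B@P1+A@P2) × C-iv(H2)», summarised «K × C-iv»
(cell rule R137); NOTHING is asserted about them here.

WHAT THIS LEAF DOES.  In dimension `d` one link sees `2(d−1)` plaquettes, so the tilt radius is `2(d−1)|β_W|/9`; the modulus `K = 7/5` is
certified on the ball of radius `11/30`, i.e. for `(d−1)|β_W| ≤ 33/20`; and at that cap the door coefficient `c = (7/5)|β_W|/9 ≤ 77/(300(d−1))`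
satisfies `doorPoly d c ≤ 77/75 − (0.2498…)/(d−1) < 1` exactly when `d ≤ 10` (`d = 10`: `0.99891…`; `d = 11`: `1.0017…`, door SHUT).  Hence

* `su3_massGapAt_dim_of_door` (every `d ≥ 2`): H1′ ∧ H2 ∧ `(d−1)|β_W| ≤ 33/20` ∧ `doorPoly d ((7/5)|β_W|/9) < 1` ⇒ `MassGapAt d 3 (β_W/9)`
  (H1′ = the radius-`11/30` restriction `OneLinkPoincareSUN 3 (11/30) (4/5)` of H1);
* ★ `su3_massGapAt_dim_of_certificates` (every `2 ≤ d ≤ 10`): H1 ∧ H2 ∧ `(d−1)|β_W| ≤ 33/20` ⇒ `MassGapAt d 3 (β_W/9)` — the row is capped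
  by the certified RADIUS in every dimension up to `10`; `d = 3`: `|β_W| ≤ 33/40 = 0.825`; `d = 4`: `11/20` (the `d = 4` file's row, here
  re-derived through the general door); `d = 5`: `33/80`; `d = 6`: `33/100`;
* the same rows in the `DLRMassGapAt` and `StrongCouplingPhaseAt` currencies (tree bridges `massGapAt_iff_dlrMassGapAt`,
  `HessianSharp.strongCouplingPhaseAt_of_massGapAt`).

COMPARISON (same predicate, each in its class): ds-1's hypothesis-free all-`N` row `(d−1)|x| ≤ 1/12`, i.e. for `SU(3)` `(d−1)|β_W| ≤ 3/4`
(`StarDimMassGap.massGapAt_SU_of_abs_le`, K); printed Shen–Zhu–Zhu `|x| < 1/(16(d−1))`, i.e. `(d−1)|β_W| < 9/16`; this file `33/20`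
(`× 11/5` over the all-`N` row, `× 44/15` over print, uniformly in `2 ≤ d ≤ 10`).  No rate beyond `∃ c > 0`; `d = 2` is formal (solvable model).
-/

noncomputable section

open MeasureTheory ProbabilityTheory Function Finset
open Literature.Probability.LatticeModels
open Literature.MathematicalPhysics.QuantumLattice (fundamentalRep ymSpecification)
open Literature.MathematicalPhysics.QuantumFieldTheory
open Literature.MathematicalPhysics.QuantumFieldTheory.Balaban1983to89
open Literature.MathematicalPhysics.QuantumFieldTheory.Balaban1983to89.StrongCouplingDobrushinWindow
  (OneLinkKRModulus DLRMassGapAt)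
open Summit.QuantumFields.BalabanUV.InfraRed.StrongCouplingVarianceDoorSUN (OneLinkVarianceBound)
open Summit.QuantumFields.BalabanUV.InfraRed.StrongCouplingPoincareDoorSUN (OneLinkPoincareSUN)
open Summit.Ventures.YMGap.StarResolventDim (doorPoly doorPoly_lt_one_mono)
open Summit.Ventures.YMGap.StarSU3Certified (su3_oneLinkKRModulus_sevenFifths poincare_elevenThirtieths_of_threeFifths
  abs_div_nine)

namespace Summit.Ventures.YMGap.StarSU3CertifiedDim

variable {d : ℕ}

/-! ### 1. The socket-fed row in dimension `d` with the door displayed -/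

/-- **`SU(3)`, dimension `d ≥ 2`: `MassGapAt d 3 (β_W/9)` from the certified modulus `K = 7/5`, door displayed.**  GIVEN
`OneLinkPoincareSUN 3 (11/30) (4/5)` and `OneLinkVarianceBound 3 (11/30) (49/20)` (certified computations, displayed), every Wilson `β_W`
with `(d−1)|β_W| ≤ 33/20` (tilt radius `2(d−1)|β_W|/9 ≤ 11/30`) and `doorPoly d ((7/5)|β_W|/9) < 1` carries `MassGapAt d 3 (β_W/9)` —
ds-1's `StarDimMassGap.massGapAt_of_oneLinkKRModulus` with `K = 7/5`. [folklore] -/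
theorem su3_massGapAt_dim_of_door (hd : 2 ≤ d) (hP : OneLinkPoincareSUN 3 (11 / 30) (4 / 5))
    (hv : OneLinkVarianceBound 3 (11 / 30) (49 / 20)) {βW : ℝ} (hR : ((d : ℝ) - 1) * |βW| ≤ 33 / 20)
    (hdoor : doorPoly d (7 / 5 * (|βW| / 9)) < 1) : MassGapAt d 3 (βW / 9) := by
  refine StarDimMassGap.massGapAt_of_oneLinkKRModulus hd (by norm_num) (by norm_num) ?_
    (su3_oneLinkKRModulus_sevenFifths hP hv) ?_
  · rw [abs_div_nine]; nlinarith [abs_nonneg βW]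
  · rw [abs_div_nine]; exact hdoor

/-- The door arithmetic, uniformly in `2 ≤ d ≤ 10`: `(d−1)|β_W| ≤ 33/20` forces `doorPoly d ((7/5)|β_W|/9) < 1` (the coefficient is at most
`77/(300(d−1))`, and `doorPoly d (77/(300(d−1))) < 1` for `d = 2, …, 10` — checked case by case (`omega` case split); it FAILS at `d = 11`). [folklore] -/
theorem door_of_le_ten (hd : 2 ≤ d) (hd10 : d ≤ 10) {βW : ℝ} (hR : ((d : ℝ) - 1) * |βW| ≤ 33 / 20) :
    doorPoly d (7 / 5 * (|βW| / 9)) < 1 := by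
  have h0 : 0 ≤ 7 / 5 * (|βW| / 9) := by positivity
  have hcases : d = 2 ∨ d = 3 ∨ d = 4 ∨ d = 5 ∨ d = 6 ∨ d = 7 ∨ d = 8 ∨ d = 9 ∨ d = 10 := by omega
  rcases hcases with rfl | rfl | rfl | rfl | rfl | rfl | rfl | rfl | rfl
  · exact doorPoly_lt_one_mono (by norm_num) h0 (by push_cast at hR; linarith : 7 / 5 * (|βW| / 9) ≤ 77 / 300)
      (by unfold doorPoly; norm_num)
  · exact doorPoly_lt_one_mono (by norm_num) h0 (by push_cast at hR; linarith : 7 / 5 * (|βW| / 9) ≤ 77 / 600)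
      (by unfold doorPoly; norm_num)
  · exact doorPoly_lt_one_mono (by norm_num) h0 (by push_cast at hR; linarith : 7 / 5 * (|βW| / 9) ≤ 77 / 900)
      (by unfold doorPoly; norm_num)
  · exact doorPoly_lt_one_mono (by norm_num) h0 (by push_cast at hR; linarith : 7 / 5 * (|βW| / 9) ≤ 77 / 1200)
      (by unfold doorPoly; norm_num)
  · exact doorPoly_lt_one_mono (by norm_num) h0 (by push_cast at hR; linarith : 7 / 5 * (|βW| / 9) ≤ 77 / 1500)
      (by unfold doorPoly; norm_num)
  · exact doorPoly_lt_one_mono (by norm_num) h0 (by push_cast at hR; linarith : 7 / 5 * (|βW| / 9) ≤ 77 / 1800)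
      (by unfold doorPoly; norm_num)
  · exact doorPoly_lt_one_mono (by norm_num) h0 (by push_cast at hR; linarith : 7 / 5 * (|βW| / 9) ≤ 77 / 2100)
      (by unfold doorPoly; norm_num)
  · exact doorPoly_lt_one_mono (by norm_num) h0 (by push_cast at hR; linarith : 7 / 5 * (|βW| / 9) ≤ 77 / 2400)
      (by unfold doorPoly; norm_num)
  · exact doorPoly_lt_one_mono (by norm_num) h0 (by push_cast at hR; linarith : 7 / 5 * (|βW| / 9) ≤ 77 / 2700)
      (by unfold doorPoly; norm_num)

/-! ### 2. ★ The rows of record: `SU(3)` in every dimension `2 ≤ d ≤ 10` on the cell's certificates H1, H2 -/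

/-- ★ **`SU(3)`, EVERY DIMENSION `2 ≤ d ≤ 10`: `MassGapAt d 3 (β_W/9)` at every Wilson `(d−1)|β_W| ≤ 33/20`, TWO-SIDED, ON THE CELL'S
CERTIFICATES** — displayed hypotheses exactly H1 `OneLinkPoincareSUN 3 (3/5) (4/5)` (`pub-ymgap`, σ2 engines A + B) and H2
`OneLinkVarianceBound 3 (11/30) (49/20)` (`pub-balaban` g17 + `pub-ymgap` replay): DLR uniqueness on `ℤ^d` and the Shen–Zhu–Zhu covariance
clause for every DLR state.  The cap is the certified RADIUS (`2(d−1)|β_W|/9 ≤ 11/30`), the door being open there for every `d ≤ 10`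
(`door_of_le_ten`).  Rows: `d = 3`: `|β_W| ≤ 33/40`; `d = 4`: `11/20`; `d = 5`: `33/80`; `d = 6`: `33/100`; …; `d = 10`: `11/60`.  Same predicate,
hypothesis-free (ds-1): `(d−1)|β_W| ≤ 3/4`; printed: `(d−1)|β_W| < 9/16`.  Class «K × C(H1: A@P1+B@P1+A@P2) × C-iv(H2)» (R137/R144, F-214). [folklore] -/
theorem su3_massGapAt_dim_of_certificates (hd : 2 ≤ d) (hd10 : d ≤ 10) (hP : OneLinkPoincareSUN 3 (3 / 5) (4 / 5))
    (hv : OneLinkVarianceBound 3 (11 / 30) (49 / 20)) {βW : ℝ} (hR : ((d : ℝ) - 1) * |βW| ≤ 33 / 20) :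
    MassGapAt d 3 (βW / 9) :=
  su3_massGapAt_dim_of_door hd (poincare_elevenThirtieths_of_threeFifths hP) hv hR (door_of_le_ten hd hd10 hR)

/-- ★ **`SU(3)`, every `2 ≤ d ≤ 10`, SC-a currency: `DLRMassGapAt d 3 (β_W/9)` at every `(d−1)|β_W| ≤ 33/20` on the cell's certificates**
H1, H2 (tree dictionary `massGapAt_iff_dlrMassGapAt`). [folklore] -/
theorem su3_dlrMassGapAt_dim_of_certificates (hd : 2 ≤ d) (hd10 : d ≤ 10) (hP : OneLinkPoincareSUN 3 (3 / 5) (4 / 5))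
    (hv : OneLinkVarianceBound 3 (11 / 30) (49 / 20)) {βW : ℝ} (hR : ((d : ℝ) - 1) * |βW| ≤ 33 / 20) :
    DLRMassGapAt d 3 (βW / 9) :=
  massGapAt_iff_dlrMassGapAt.1 (su3_massGapAt_dim_of_certificates hd hd10 hP hv hR)

/-- ★ **`SU(3)`, every `2 ≤ d ≤ 10`: the strong-coupling PHASE predicate `HessianSharp.StrongCouplingPhaseAt d 3 (β_W/3)`** at every
`(d−1)|β_W| ≤ 33/20` on the cell's certificates H1, H2 (p2's bridge `strongCouplingPhaseAt_of_massGapAt`). [folklore] -/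
theorem su3_strongCouplingPhaseAt_dim_of_certificates (hd : 2 ≤ d) (hd10 : d ≤ 10)
    (hP : OneLinkPoincareSUN 3 (3 / 5) (4 / 5)) (hv : OneLinkVarianceBound 3 (11 / 30) (49 / 20)) {βW : ℝ}
    (hR : ((d : ℝ) - 1) * |βW| ≤ 33 / 20) : HessianSharp.StrongCouplingPhaseAt d 3 (βW / 3) := by
  refine HessianSharp.strongCouplingPhaseAt_of_massGapAt (by norm_num) hd ?_
  have e : βW / 3 / ((3 : ℕ) : ℝ) = βW / 9 := by push_cast; ring
  rw [e]
  exact su3_massGapAt_dim_of_certificates hd hd10 hP hv hR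

/-! ### 3. Named rows -/

/-- **`SU(3)`, `d = 3`: `MassGapAt 3 3 (β_W/9)` at every Wilson `|β_W| ≤ 33/40 = 0.825`** on the cell's certificates H1, H2 (hypothesis-free
all-`N` row at `d = 3`: `|β_W| ≤ 2/5` via `ImprovedThreshold 3 N (2/45)`; printed `9/32`). [folklore] -/
theorem su3_three_massGapAt_of_certificates (hP : OneLinkPoincareSUN 3 (3 / 5) (4 / 5))
    (hv : OneLinkVarianceBound 3 (11 / 30) (49 / 20)) {βW : ℝ} (h : |βW| ≤ 33 / 40) : MassGapAt 3 3 (βW / 9) :=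
  su3_massGapAt_dim_of_certificates (by norm_num) (by norm_num) hP hv (by push_cast; linarith)

/-- **`SU(3)`, `d = 5`: `MassGapAt 5 3 (β_W/9)` at every Wilson `|β_W| ≤ 33/80`** on the cell's certificates H1, H2 (hypothesis-free all-`N`
row: `|β_W| ≤ 3/16`; printed `9/64`). [folklore] -/
theorem su3_five_massGapAt_of_certificates (hP : OneLinkPoincareSUN 3 (3 / 5) (4 / 5))
    (hv : OneLinkVarianceBound 3 (11 / 30) (49 / 20)) {βW : ℝ} (h : |βW| ≤ 33 / 80) : MassGapAt 5 3 (βW / 9) :=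
  su3_massGapAt_dim_of_certificates (by norm_num) (by norm_num) hP hv (by push_cast; linarith)

/-- **`SU(3)`, `d = 6`: `MassGapAt 6 3 (β_W/9)` at every Wilson `|β_W| ≤ 33/100`** on the cell's certificates H1, H2 (hypothesis-free all-`N`
row: `|β_W| ≤ 3/20`; printed `9/80`). [folklore] -/
theorem su3_six_massGapAt_of_certificates (hP : OneLinkPoincareSUN 3 (3 / 5) (4 / 5))
    (hv : OneLinkVarianceBound 3 (11 / 30) (49 / 20)) {βW : ℝ} (h : |βW| ≤ 33 / 100) : MassGapAt 6 3 (βW / 9) :=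
  su3_massGapAt_dim_of_certificates (by norm_num) (by norm_num) hP hv (by push_cast; linarith)

/- Consistency at `d = 4` (an `example`, NOT re-booked: the statement is the `d = 4` file's
`StarSU3Certified.su3_massGapAt_abs_le_of_certificates`, there obtained through the `d = 4` star stack): the general door re-derives
the row `|β_W| ≤ 11/20`. -/
example (hP : OneLinkPoincareSUN 3 (3 / 5) (4 / 5))
    (hv : OneLinkVarianceBound 3 (11 / 30) (49 / 20)) {βW : ℝ} (h : |βW| ≤ 11 / 20) : MassGapAt 4 3 (βW / 9) :=
  su3_massGapAt_dim_of_certificates (by norm_num) (by norm_num) hP hv (by push_cast; linarith)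

/-! ### 4. Numbers -/

/-- Numbers: the door values `doorPoly d (77/(300(d−1)))` at `d = 3, 5, 6, 10` are `< 1` and at `d = 11` the door is SHUT (`> 1`); the radius
identity `2(d−1)·(33/(20(d−1)))/9 = 11/30` at `d = 3, 4, 5`; the rows `33/(20(d−1))` at `d = 3, 4, 5, 6, 10`; ratios to the hypothesis-free all-`N`
row `3/(4(d−1))` (`11/5`) and to print `9/(16(d−1))` (`44/15`). [folklore] -/
theorem certifiedDim_numbers :
    doorPoly 3 (77 / 600) < 1 ∧ doorPoly 5 (77 / 1200) < 1 ∧ doorPoly 6 (77 / 1500) < 1 ∧ doorPoly 10 (77 / 2700) < 1 ∧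
      1 < doorPoly 11 (77 / 3000) ∧
      2 * ((3 : ℝ) - 1) * (33 / 40) / 9 = 11 / 30 ∧ 2 * ((4 : ℝ) - 1) * (11 / 20) / 9 = 11 / 30 ∧
      2 * ((5 : ℝ) - 1) * (33 / 80) / 9 = 11 / 30 ∧
      (33 : ℝ) / (20 * (3 - 1)) = 33 / 40 ∧ (33 : ℝ) / (20 * (4 - 1)) = 11 / 20 ∧ (33 : ℝ) / (20 * (5 - 1)) = 33 / 80 ∧
      (33 : ℝ) / (20 * (6 - 1)) = 33 / 100 ∧ (33 : ℝ) / (20 * (10 - 1)) = 11 / 60 ∧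
      (33 / 20 : ℝ) / (3 / 4) = 11 / 5 ∧ (33 / 20 : ℝ) / (9 / 16) = 44 / 15 := by
  unfold doorPoly
  norm_num

end Summit.Ventures.YMGap.StarSU3CertifiedDim

end
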